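/-
Copyright (c) 2026 the pub-hodgecm-mathlib formalisation cell (harness21).  Prover seat hodgecm-mathlib-LH7-p09 (g2), CLOSE-OUT ROSTER strike line L3∕L5 (Track A
«(D-RAM) FOUR-FRAME» squad F0∕P3c∕LH4 ∕ F0∕P3c∕LH7); β₂-BOARD row (L-P) «populated ∕ unlabelled cells pay 0» (lineage LH7-p09), the OFF-ROW half asked by the β₂ sub-dealer
LH4-p04 (g9) (L-Σ-3B) ED. 2 «OFF-ROW ZERO» (this seat's cone-cell census 22:37:23Z); helper lane on h413 = stmt-HodgeConjecture-24833 (count-neutral).  2026-09-04.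
-/
import Summits.HodgeConjecture.HodgeConjecture.Theorems.F0P3cDyRamTerminalCellOffShellCardTwo   -- ★ p862572 (this seat): the `Fix ρ`-coordinates `map_sub_div_eq`, `mul_map_sub_mul_map_eq`; brings ★ DEFS `levelSetDep`, `forall_herm_mul_mem_iff_isOrd_div`, ★ p862037 transports
import HarnessLib

/-!
# Crux `H413`, line LH4 «(D-RAM) FOUR-FRAME» — the (β₂) road (R-36) «PURE-CELL LEDGER», row (L-P) ∕ (L-Σ-3B) ED. 2 «OFF-ROW ZERO»: «A FAR CONE CELL IS EMPTY» — beyond the lower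
# anti-diagonal (`|μ − ρμ| > |cc(α − ρα)|·|ϖE|^b`) and right of the upper line (`|μ − ρμ|·|ϖE|^b > |cc(α − ρα)|·|μ|`), or above the row and left of the upper line, the DEPTH
# clause fails for EVERY `Y` of the cell: `levelSetDep(j, b; μ) = ∅` (any `q`, any `d`)

Cell `hodgecm-mathlib` (D-0151), FLOOR 0, crux item H413 = `stmt-HodgeConjecture-24833`, route of record `HCCMUnconditional`; squads F0∕P3c∕LH4 ∕ LH7; lane
`--supports stmt-HodgeConjecture-24833 --as helper` (count-neutral; pays NO tier-0 row).  THEOREMS ONLY (no `def`, no instance, no notation, no `sorry`, default heartbeats);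
★-only imports; states NO law; (β₂) stays a HYPOTHESIS.  DATUM-FREE: ★ DEFS `F0P3cDyRamToricCensusDefs` letters (`IsOrd`, `dualGen`, `levelSetDep`) over the line model
`(M, jE, ρ, Θ, α)` (★ (C1) letters); NO residue-field hypothesis.

WHY (this seat's CONE-CELL CENSUS for LH4-p04 (g9)'s ED. 2, squad bus 22:37:23Z).  In the `Fix ρ`-coordinates of ★ p862572 (`μ = A + B·α`, `Y = P + Q·α`,
`(μ∕Y − ρ(μ∕Y))·Y·ρY = (BP − AQ)(α − ρα)`, `|B|·|α − ρα| = |μ − ρμ|`, `|P| = |Y| = |ϖE|^b` when `|cc| < |ϖE|^b`, `|Q| ≤ |cc|` with EQUALITY for a Gram-primitive `Y`,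
`|A| = |μ|` when `|B| < |μ|`) the depth clause `IsOrd cc (μ∕Y)` of ★ DEFS `levelSetDep(j, b; μ)` (★ `forall_herm_mul_mem_iff_isOrd_div`) is `|BP − AQ| ≤ |cc|·|ϖE|^{2b}`.  With
`m₀ = v(μ)`, `jl′ = v(μ − ρμ) − v(α − ρα)`: if ONE of `|BP| = |ϖE|^{jl′+b}`, `|AQ| = |ϖE|^{m₀+j}` STRICTLY dominates the other AND exceeds `|cc|·|ϖE|^{2b} = |ϖE|^{j+2b}`, the
clause fails for every `Y` of the cell and the cell is EMPTY:
* §1 `v_sub_map_div_eq_of_primitive` — `|Q| = |cc|` for a Gram-primitive `Y ∈ 𝒪_cc` with `|Y| ≤ |ϖE|` (`hEval`).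
* §2 `not_isOrd_div_of_far` — `|BP|` dominant: `|cc(α − ρα)|·|μ| < |μ − ρμ|·|ϖE|^b` (right of the upper line `j − b = jl′ − m₀`) and `|cc(α − ρα)|·|ϖE|^b < |μ − ρμ|` (beyond the lower
  anti-diagonal `j + b = jl′`) ⇒ `¬ IsOrd cc (μ∕Y)` — sizes only.  `not_isOrd_div_of_high` — `|AQ|` dominant: `|ϖE|^{2b} < |μ|` (above the row) and `|μ − ρμ|·|ϖE|^b < |cc(α − ρα)|·|μ|`
  (left of the upper line) ⇒ `¬ IsOrd cc (μ∕Y)` — needs `|Q| = |cc|` (§1).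
* §3 CELL HEADS `levelSetDep_eq_empty_of_far` ∕ `levelSetDep_eq_empty_of_high` — `levelSetDep ρ Θ α (jE ϖ) h j b μ = ∅` under the index letters (`cc = (jE ϖ)^j`, `b < j`), so the
  (L-Σ-3B) ED. 2 folds these cells of ★ p861305's sum with `finsum_mem_empty` — no glued lattice, no label, no weight.
Together with ★ `…DeepConeCellOffShell` (deep cells off the shell) this is «OFF-ROW ZERO» except on the two live off-row lines LOWER `j + b = jl′` (`2b < m₀`) and UPPER
`j − b = jl′ − m₀` (`2b > m₀`), which every engine table (LH4-cdis1 `CELLCHECK.out`) shows populated and BALANCED — the ε-exchange road ★ p862261, NOT this file.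
HONEST LABEL.  Count-neutral valuation algebra; nothing printed is asserted; no census law is stated; `HC_CM` is proved only modulo the 7 printed citations (2 remaining named inputs:
hLiu418 = `stmt-HodgeConjecture-24832`, h413 = `stmt-HodgeConjecture-24833`) until rung 0 closes.
## References
* [Serre1979] J.-P. Serre, *Local Fields*, GTM 67 (1979): Ch. III §6 Prop. 12 (orders of conductor `c`).
* [Kottwitz1986BaseChangeUnits] R. E. Kottwitz, *Base change for unit elements of Hecke algebras*, Compositio Math. 60 (1986): §1 pp. 240–241 (the depth-refined cells).
* [Jacobowitz1962] R. Jacobowitz, *Hermitian forms over local fields*, Amer. J. Math. 84 (1962): §4 (duals, gluing).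
* [Rogawski1990] J. D. Rogawski, *Automorphic Representations of Unitary Groups in Three Variables*, Ann. of Math. Stud. 123 (1990): §4.9 Prop. 4.9.1 (b) p. 55.
-/

set_option autoImplicit false

noncomputable section

namespace Summit.HodgeConjecture.HodgeConjecture.Cruxes.H413.F0P3cDyRamFarConeCellEmpty

open scoped Valued WithZero
open WithZero
open Summit.HodgeConjecture.HodgeConjecture.Cruxes.H413.F0P3cDyRamToricCensusDefs
open Summit.HodgeConjecture.HodgeConjecture.Cruxes.H413.F0P3cDyRamBoundaryCellLetterCardTwo (v_map_lt_one_iff_of_le_iff)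
open Summit.HodgeConjecture.HodgeConjecture.Cruxes.H413.F0P3cDyRamTerminalCellOffShellCardTwo (map_sub_div_eq mul_map_sub_mul_map_eq)

variable {E M : Type} [Field E] [Valued E ℤᵐ⁰] [Field M] [Valued M ℤᵐ⁰] {ρ Θ : M →+* M} {α : M}

/-! ## §1 The `α`-coordinate of a Gram-primitive `Y` has EXACTLY the size of the conductor -/

/-- **`|Q| = |cc|` FOR A GRAM-PRIMITIVE `Y`.**  `ρ` an involution fixing exactly `jE(E)`, fixed integers have sizes in `|ϖE|^ℕ` (`hEval`), `|ϖ| = exp(−1)`; `cc` fixed non-zero;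
`Y ∈ 𝒪_cc` (`IsOrd`) with `|Y| ≤ |ϖE|` and `Y∕ϖE ∉ 𝒪_cc`.  THEN `|(Y − ρY)∕(α − ρα)| = |cc|`. [cite: Serre1979, Ch. III §6 Prop. 12] [cite: Jacobowitz1962, §4] -/
theorem v_sub_map_div_eq_of_primitive
    (hρρ : ∀ x, ρ (ρ x) = x) (hα : ρ α ≠ α)
    (jE : E →+* M) (hjv : ∀ c, Valued.v (jE c) ≤ 1 ↔ Valued.v c ≤ 1) (hjfix : ∀ z, ρ z = z ↔ ∃ c, jE c = z)
    {ϖ : E} (hϖ : Valued.v ϖ = exp (-1 : ℤ))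
    (hEval : ∀ c : M, ρ c = c → c ≠ 0 → Valued.v c ≤ 1 → ∃ n : ℕ, Valued.v c = Valued.v (jE ϖ) ^ n)
    {cc : M} (hc : ρ cc = cc) (hc0 : cc ≠ 0) {Y : M} (hYO : IsOrd ρ α cc Y) (hYp : ¬ IsOrd ρ α cc (Y / jE ϖ)) (hY1 : Valued.v Y ≤ Valued.v (jE ϖ)) :
    Valued.v ((Y - ρ Y) / (α - ρ α)) = Valued.v cc := by
  have hα0 : α - ρ α ≠ 0 := sub_ne_zero.2 (Ne.symm hα)
  have hvα0 : Valued.v (α - ρ α) ≠ 0 := (Valuation.ne_zero_iff _).2 hα0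
  have hvαpos : 0 < Valued.v (α - ρ α) := zero_lt_iff.2 hvα0
  have hvϖ0 : Valued.v ϖ ≠ 0 := by rw [hϖ]; exact exp_ne_zero
  have hϖ0 : ϖ ≠ 0 := fun h0 => hvϖ0 (by rw [h0, map_zero])
  have hϖlt : Valued.v ϖ < 1 := by rw [hϖ, ← exp_zero, exp_lt_exp]; norm_num
  have hjϖ0 : jE ϖ ≠ 0 := (map_ne_zero jE).2 hϖ0
  have hvjϖ0 : Valued.v (jE ϖ) ≠ 0 := (Valuation.ne_zero_iff _).2 hjϖ0
  have hvjϖpos : 0 < Valued.v (jE ϖ) := zero_lt_iff.2 hvjϖ0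
  have hjϖlt : Valued.v (jE ϖ) < 1 := (v_map_lt_one_iff_of_le_iff jE hjv ϖ).2 hϖlt
  have hρϖ : ρ (jE ϖ) = jE ϖ := (hjfix _).2 ⟨ϖ, rfl⟩
  have hvc0 : Valued.v cc ≠ 0 := (Valuation.ne_zero_iff _).2 hc0
  set Q : M := (Y - ρ Y) / (α - ρ α) with hQdef
  have hρQ : ρ Q = Q := map_sub_div_eq hρρ Y
  have hvQle : Valued.v Q ≤ Valued.v cc := by
    rw [hQdef, Valuation.map_div, div_le_iff₀ hvαpos, ← Valuation.map_mul]
    exact hYO.2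
  have hvQgt : Valued.v cc * Valued.v (jE ϖ) < Valued.v Q := by
    have h1 : Valued.v (Y / jE ϖ) ≤ 1 := by rw [Valuation.map_div, div_le_one₀ hvjϖpos]; exact hY1
    have h2 : ¬ Valued.v (Y / jE ϖ - ρ (Y / jE ϖ)) ≤ Valued.v (cc * (α - ρ α)) := fun h => hYp ⟨h1, h⟩
    rw [not_le, map_div₀, hρϖ, ← sub_div, Valuation.map_div, lt_div_iff₀ hvjϖpos] at h2
    rw [hQdef, Valuation.map_div, lt_div_iff₀ hvαpos]
    calc Valued.v cc * Valued.v (jE ϖ) * Valued.v (α - ρ α) = Valued.v (cc * (α - ρ α)) * Valued.v (jE ϖ) := by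
          rw [Valuation.map_mul]; ac_rfl
      _ < Valued.v (Y - ρ Y) := h2
  have hQ0 : Q ≠ 0 := fun h0 => by
    rw [h0, Valuation.map_zero] at hvQgt
    exact absurd hvQgt (not_lt.2 zero_le)
  have hρQc : ρ (Q / cc) = Q / cc := by rw [map_div₀, hρQ, hc]
  have hle : Valued.v (Q / cc) ≤ 1 := by rw [Valuation.map_div, div_le_one₀ (zero_lt_iff.2 hvc0)]; exact hvQle
  obtain ⟨n, hn⟩ := hEval _ hρQc (div_ne_zero hQ0 hc0) hle
  have hgt : Valued.v (jE ϖ) < Valued.v (Q / cc) := by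
    rw [Valuation.map_div, lt_div_iff₀ (zero_lt_iff.2 hvc0), mul_comm]; exact hvQgt
  rw [hn] at hgt
  have hn0 : n = 0 := by
    by_contra hne
    have h := pow_le_pow_right_of_le_one' hjϖlt.le (Nat.one_le_iff_ne_zero.2 hne)
    rw [pow_one] at h
    exact absurd (lt_of_lt_of_le hgt h) (lt_irrefl _)
  rw [hn0, pow_zero, Valuation.map_div, div_eq_one_iff_eq hvc0] at hn
  exact hn

/-! ## §2 The two far regimes: one coordinate term dominates and the depth clause fails -/

/-- **FAR (the `B·P` term dominates; sizes only).**  `ρ` isometric, `ρα ≠ α`, `|α| ≤ 1`, `|ϖ| = exp(−1)`; CELL `Y ∈ 𝒪_cc`, `|Y| = |ϖE|^b`, `|cc| < |ϖE|^b`;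
FAR letters `|cc(α − ρα)|·|μ| < |μ − ρμ|·|ϖE|^b` (right of the upper line) and `|cc(α − ρα)|·|ϖE|^b < |μ − ρμ|` (beyond the lower anti-diagonal).  THEN `¬ IsOrd ρ α cc (μ∕Y)`: the
depth clause of the cone cell fails at `Y`. [cite: Kottwitz1986BaseChangeUnits, §1 pp. 240–241] [cite: Serre1979, Ch. III §6 Prop. 12] -/
theorem not_isOrd_div_of_far
    (hvρ : ∀ x, Valued.v (ρ x) = Valued.v x) (hα : ρ α ≠ α) (hα1 : Valued.v α ≤ 1)
    (jE : E →+* M) {ϖ : E} (hϖ : Valued.v ϖ = exp (-1 : ℤ))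
    {cc : M} {Y : M} (hYO : IsOrd ρ α cc Y) {b : ℕ} (hYb : Valued.v Y = Valued.v (jE ϖ) ^ b) (hcb : Valued.v cc < Valued.v (jE ϖ) ^ b)
    {μ : M} (h1 : Valued.v (cc * (α - ρ α)) * Valued.v μ < Valued.v (μ - ρ μ) * Valued.v (jE ϖ) ^ b)
    (h2 : Valued.v (cc * (α - ρ α)) * Valued.v (jE ϖ) ^ b < Valued.v (μ - ρ μ)) :
    ¬ IsOrd ρ α cc (μ / Y) := by
  intro hO
  have hα0 : α - ρ α ≠ 0 := sub_ne_zero.2 (Ne.symm hα)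
  have hvα0 : Valued.v (α - ρ α) ≠ 0 := (Valuation.ne_zero_iff _).2 hα0
  have hvαpos : 0 < Valued.v (α - ρ α) := zero_lt_iff.2 hvα0
  have hvϖ0 : Valued.v ϖ ≠ 0 := by rw [hϖ]; exact exp_ne_zero
  have hϖ0 : ϖ ≠ 0 := fun h0 => hvϖ0 (by rw [h0, map_zero])
  have hjϖ0 : jE ϖ ≠ 0 := (map_ne_zero jE).2 hϖ0
  have hvjϖ0 : Valued.v (jE ϖ) ≠ 0 := (Valuation.ne_zero_iff _).2 hjϖ0
  have hvjϖpos : 0 < Valued.v (jE ϖ) := zero_lt_iff.2 hvjϖ0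
  have hY0 : Y ≠ 0 := fun h0 => by
    rw [h0, Valuation.map_zero] at hYb
    exact pow_ne_zero b hvjϖ0 hYb.symm
  have hρY0 : ρ Y ≠ 0 := (map_ne_zero ρ).2 hY0
  have hpbpos : 0 < Valued.v (jE ϖ) ^ b := pow_pos hvjϖpos _
  -- `μ − ρμ ≠ 0`
  have hantipos : 0 < Valued.v (μ - ρ μ) := lt_of_le_of_lt zero_le h2
  -- coordinates
  set B : M := (μ - ρ μ) / (α - ρ α) with hBdef
  set Q : M := (Y - ρ Y) / (α - ρ α) with hQdef
  set A : M := μ - B * α with hAdef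
  set P : M := Y - Q * α with hPdef
  clear_value A P
  clear_value B Q
  have hvB : Valued.v B * Valued.v (α - ρ α) = Valued.v (μ - ρ μ) := by
    rw [hBdef, Valuation.map_div, div_mul_cancel₀ _ hvα0]
  have hvBpos : 0 < Valued.v B := by
    have h : Valued.v B ≠ 0 := fun h0 => by rw [h0, zero_mul] at hvB; exact hantipos.ne hvB
    exact zero_lt_iff.2 h
  have hvQ : Valued.v Q * Valued.v (α - ρ α) ≤ Valued.v (cc * (α - ρ α)) := by
    rw [hQdef, Valuation.map_div, div_mul_cancel₀ _ hvα0]; exact hYO.2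
  have hvQ' : Valued.v Q ≤ Valued.v cc := by
    rw [Valuation.map_mul] at hvQ
    exact le_of_mul_le_mul_right hvQ hvαpos
  have hvP : Valued.v P = Valued.v (jE ϖ) ^ b := by
    have hlt : Valued.v (Q * α) < Valued.v Y := by
      rw [Valuation.map_mul, hYb]
      calc Valued.v Q * Valued.v α ≤ Valued.v cc * 1 := mul_le_mul' hvQ' hα1
        _ = Valued.v cc := mul_one _
        _ < Valued.v (jE ϖ) ^ b := hcb
    rw [hPdef, sub_eq_add_neg, Valuation.map_add_eq_of_lt_left _ (by rw [Valuation.map_neg]; exact hlt), hYb]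
  -- dominance `|A Q| < |B P|`, compared after multiplying by `|α − ρα|`
  have hBP : Valued.v (B * P) * Valued.v (α - ρ α) = Valued.v (μ - ρ μ) * Valued.v (jE ϖ) ^ b := by
    rw [Valuation.map_mul, hvP, mul_right_comm, hvB]
  have hAQ : Valued.v (A * Q) * Valued.v (α - ρ α) < Valued.v (μ - ρ μ) * Valued.v (jE ϖ) ^ b := by
    rw [hAdef, sub_mul]
    refine lt_of_le_of_lt (mul_le_mul_left (Valuation.map_sub _ _ _) _) ?_
    rcases le_total (Valued.v (μ * Q)) (Valued.v (B * α * Q)) with hle | hle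
    · rw [max_eq_right hle, Valuation.map_mul, Valuation.map_mul, mul_assoc, mul_assoc]
      calc Valued.v B * (Valued.v α * (Valued.v Q * Valued.v (α - ρ α))) ≤ Valued.v B * (1 * Valued.v (cc * (α - ρ α))) :=
            mul_le_mul_right (mul_le_mul' hα1 hvQ) _
        _ = Valued.v B * Valued.v (α - ρ α) * Valued.v cc := by rw [Valuation.map_mul, one_mul]; ac_rfl
        _ = Valued.v (μ - ρ μ) * Valued.v cc := by rw [hvB]
        _ < Valued.v (μ - ρ μ) * Valued.v (jE ϖ) ^ b := mul_lt_mul_of_pos_left hcb hantipos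
    · rw [max_eq_left hle, Valuation.map_mul, mul_assoc]
      calc Valued.v μ * (Valued.v Q * Valued.v (α - ρ α)) ≤ Valued.v μ * Valued.v (cc * (α - ρ α)) := mul_le_mul_right hvQ _
        _ = Valued.v (cc * (α - ρ α)) * Valued.v μ := mul_comm _ _
        _ < Valued.v (μ - ρ μ) * Valued.v (jE ϖ) ^ b := h1
  have hdom : Valued.v (A * Q) < Valued.v (B * P) := by
    have h : Valued.v (A * Q) * Valued.v (α - ρ α) < Valued.v (B * P) * Valued.v (α - ρ α) := by rw [hBP]; exact hAQ
    exact lt_of_mul_lt_mul_right h hvαpos.le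
  have hdiff : Valued.v (B * P - A * Q) = Valued.v (B * P) := by
    rw [sub_eq_add_neg, Valuation.map_add_eq_of_lt_left _ (by rw [Valuation.map_neg]; exact hdom)]
  -- the depth clause bounds `|BP − AQ|·|α − ρα|` by `|cc(α − ρα)|·|Y|²`
  have hident : μ / Y - ρ (μ / Y) = (B * P - A * Q) * (α - ρ α) / (Y * ρ Y) := by
    rw [map_div₀, div_sub_div _ _ hY0 hρY0, mul_map_sub_mul_map_eq hα hBdef hAdef hQdef hPdef]
  have hO2 := hO.2
  rw [hident, Valuation.map_div, Valuation.map_mul, Valuation.map_mul, hvρ, hYb, div_le_iff₀ (mul_pos hpbpos hpbpos), hdiff, hBP] at hO2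
  -- contradiction with `h2`
  have hlt : Valued.v (μ - ρ μ) * Valued.v (jE ϖ) ^ b < Valued.v (μ - ρ μ) * Valued.v (jE ϖ) ^ b :=
    calc Valued.v (μ - ρ μ) * Valued.v (jE ϖ) ^ b ≤ Valued.v (cc * (α - ρ α)) * (Valued.v (jE ϖ) ^ b * Valued.v (jE ϖ) ^ b) := hO2
      _ = Valued.v (cc * (α - ρ α)) * Valued.v (jE ϖ) ^ b * Valued.v (jE ϖ) ^ b := (mul_assoc _ _ _).symm
      _ < Valued.v (μ - ρ μ) * Valued.v (jE ϖ) ^ b := mul_lt_mul_of_pos_right h2 hpbpos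
  exact lt_irrefl _ hlt

/-- **HIGH (the `A·Q` term dominates).**  Letters of `v_sub_map_div_eq_of_primitive` (`ρ` involution fixing `jE(E)`, `hEval`, `cc` fixed non-zero, `Y` Gram-primitive) + `ρ` isometric,
`|α| ≤ 1`; CELL `|Y| = |ϖE|^b` with `1 ≤ b`, `|cc| < |ϖE|^b`; HIGH letters `|ϖE|^{2b} < |μ|` (strictly above the row) and `|μ − ρμ|·|ϖE|^b < |cc(α − ρα)|·|μ|` (left of the upper
line).  THEN `¬ IsOrd ρ α cc (μ∕Y)`. [cite: Kottwitz1986BaseChangeUnits, §1 pp. 240–241] [cite: Serre1979, Ch. III §6 Prop. 12] -/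
theorem not_isOrd_div_of_high
    (hρρ : ∀ x, ρ (ρ x) = x) (hvρ : ∀ x, Valued.v (ρ x) = Valued.v x) (hα : ρ α ≠ α) (hα1 : Valued.v α ≤ 1)
    (jE : E →+* M) (hjv : ∀ c, Valued.v (jE c) ≤ 1 ↔ Valued.v c ≤ 1) (hjfix : ∀ z, ρ z = z ↔ ∃ c, jE c = z)
    {ϖ : E} (hϖ : Valued.v ϖ = exp (-1 : ℤ))
    (hEval : ∀ c : M, ρ c = c → c ≠ 0 → Valued.v c ≤ 1 → ∃ n : ℕ, Valued.v c = Valued.v (jE ϖ) ^ n)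
    {cc : M} (hc : ρ cc = cc) (hc0 : cc ≠ 0) {Y : M} (hYO : IsOrd ρ α cc Y) (hYp : ¬ IsOrd ρ α cc (Y / jE ϖ))
    {b : ℕ} (hb1 : 1 ≤ b) (hYb : Valued.v Y = Valued.v (jE ϖ) ^ b) (hcb : Valued.v cc < Valued.v (jE ϖ) ^ b)
    {μ : M} (h3 : Valued.v (jE ϖ) ^ (2 * b) < Valued.v μ) (h4 : Valued.v (μ - ρ μ) * Valued.v (jE ϖ) ^ b < Valued.v (cc * (α - ρ α)) * Valued.v μ) :
    ¬ IsOrd ρ α cc (μ / Y) := by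
  intro hO
  have hα0 : α - ρ α ≠ 0 := sub_ne_zero.2 (Ne.symm hα)
  have hvα0 : Valued.v (α - ρ α) ≠ 0 := (Valuation.ne_zero_iff _).2 hα0
  have hvαpos : 0 < Valued.v (α - ρ α) := zero_lt_iff.2 hvα0
  have hvϖ0 : Valued.v ϖ ≠ 0 := by rw [hϖ]; exact exp_ne_zero
  have hϖ0 : ϖ ≠ 0 := fun h0 => hvϖ0 (by rw [h0, map_zero])
  have hϖlt : Valued.v ϖ < 1 := by rw [hϖ, ← exp_zero, exp_lt_exp]; norm_num
  have hjϖ0 : jE ϖ ≠ 0 := (map_ne_zero jE).2 hϖ0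
  have hvjϖ0 : Valued.v (jE ϖ) ≠ 0 := (Valuation.ne_zero_iff _).2 hjϖ0
  have hvjϖpos : 0 < Valued.v (jE ϖ) := zero_lt_iff.2 hvjϖ0
  have hjϖlt : Valued.v (jE ϖ) < 1 := (v_map_lt_one_iff_of_le_iff jE hjv ϖ).2 hϖlt
  have hvc0 : Valued.v cc ≠ 0 := (Valuation.ne_zero_iff _).2 hc0
  have hvcpos : 0 < Valued.v cc := zero_lt_iff.2 hvc0
  have hY0 : Y ≠ 0 := fun h0 => by
    rw [h0, Valuation.map_zero] at hYb
    exact pow_ne_zero b hvjϖ0 hYb.symm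
  have hρY0 : ρ Y ≠ 0 := (map_ne_zero ρ).2 hY0
  have hpbpos : 0 < Valued.v (jE ϖ) ^ b := pow_pos hvjϖpos _
  have hμpos : 0 < Valued.v μ := lt_of_le_of_lt zero_le h3
  have hY1 : Valued.v Y ≤ Valued.v (jE ϖ) := by
    rw [hYb]
    calc Valued.v (jE ϖ) ^ b ≤ Valued.v (jE ϖ) ^ 1 := pow_le_pow_right_of_le_one' hjϖlt.le hb1
      _ = Valued.v (jE ϖ) := pow_one _
  -- coordinates
  set B : M := (μ - ρ μ) / (α - ρ α) with hBdef
  set Q : M := (Y - ρ Y) / (α - ρ α) with hQdef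
  set A : M := μ - B * α with hAdef
  set P : M := Y - Q * α with hPdef
  have hvQ : Valued.v Q = Valued.v cc := v_sub_map_div_eq_of_primitive hρρ hα jE hjv hjfix hϖ hEval hc hc0 hYO hYp hY1
  clear_value A P
  clear_value B Q
  have hvB : Valued.v B * Valued.v (α - ρ α) = Valued.v (μ - ρ μ) := by
    rw [hBdef, Valuation.map_div, div_mul_cancel₀ _ hvα0]
  -- `|B|·|ϖE|^b < |cc|·|μ|` (left of the upper line), hence `|B| < |μ|`
  have hBlt : Valued.v B * Valued.v (jE ϖ) ^ b < Valued.v cc * Valued.v μ := by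
    have h : Valued.v B * Valued.v (jE ϖ) ^ b * Valued.v (α - ρ α) < Valued.v cc * Valued.v μ * Valued.v (α - ρ α) := by
      calc Valued.v B * Valued.v (jE ϖ) ^ b * Valued.v (α - ρ α) = Valued.v (μ - ρ μ) * Valued.v (jE ϖ) ^ b := by rw [mul_right_comm, hvB]
        _ < Valued.v (cc * (α - ρ α)) * Valued.v μ := h4
        _ = Valued.v cc * Valued.v μ * Valued.v (α - ρ α) := by rw [Valuation.map_mul]; ac_rfl
    exact lt_of_mul_lt_mul_right h hvαpos.le
  have hBμ : Valued.v (B * α) < Valued.v μ := by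
    rw [Valuation.map_mul]
    have h : Valued.v B * Valued.v (jE ϖ) ^ b < Valued.v μ * Valued.v (jE ϖ) ^ b :=
      calc Valued.v B * Valued.v (jE ϖ) ^ b < Valued.v cc * Valued.v μ := hBlt
        _ ≤ Valued.v (jE ϖ) ^ b * Valued.v μ := mul_le_mul_left hcb.le _
        _ = Valued.v μ * Valued.v (jE ϖ) ^ b := mul_comm _ _
    calc Valued.v B * Valued.v α ≤ Valued.v B * 1 := mul_le_mul_right hα1 _
      _ = Valued.v B := mul_one _
      _ < Valued.v μ := lt_of_mul_lt_mul_right h hpbpos.le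
  have hvA : Valued.v A = Valued.v μ := by
    rw [hAdef, sub_eq_add_neg, Valuation.map_add_eq_of_lt_left _ (by rw [Valuation.map_neg]; exact hBμ)]
  have hvP : Valued.v P ≤ Valued.v (jE ϖ) ^ b := by
    rw [hPdef]
    refine (Valuation.map_sub _ _ _).trans (max_le hYb.le ?_)
    rw [Valuation.map_mul, hvQ]
    calc Valued.v cc * Valued.v α ≤ Valued.v cc * 1 := mul_le_mul_right hα1 _
      _ = Valued.v cc := mul_one _
      _ ≤ Valued.v (jE ϖ) ^ b := hcb.le
  -- dominance `|B P| < |A Q| = |μ|·|cc|`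
  have hAQ : Valued.v (A * Q) = Valued.v μ * Valued.v cc := by rw [Valuation.map_mul, hvA, hvQ]
  have hdom : Valued.v (B * P) < Valued.v (A * Q) := by
    rw [hAQ, Valuation.map_mul]
    calc Valued.v B * Valued.v P ≤ Valued.v B * Valued.v (jE ϖ) ^ b := mul_le_mul_right hvP _
      _ < Valued.v cc * Valued.v μ := hBlt
      _ = Valued.v μ * Valued.v cc := mul_comm _ _
  have hdiff : Valued.v (B * P - A * Q) = Valued.v μ * Valued.v cc := by
    rw [sub_eq_add_neg, add_comm, Valuation.map_add_eq_of_lt_left _ (by rw [Valuation.map_neg]; exact hdom), Valuation.map_neg, hAQ]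
  -- the depth clause bounds `|BP − AQ|·|α − ρα|` by `|cc(α − ρα)|·|Y|²`
  have hident : μ / Y - ρ (μ / Y) = (B * P - A * Q) * (α - ρ α) / (Y * ρ Y) := by
    rw [map_div₀, div_sub_div _ _ hY0 hρY0, mul_map_sub_mul_map_eq hα hBdef hAdef hQdef hPdef]
  have hO2 := hO.2
  rw [hident, Valuation.map_div, Valuation.map_mul, Valuation.map_mul, hvρ, hYb, div_le_iff₀ (mul_pos hpbpos hpbpos), hdiff, Valuation.map_mul] at hO2
  -- contradiction with `h3`
  have hlt : Valued.v μ * Valued.v cc * Valued.v (α - ρ α) < Valued.v μ * Valued.v cc * Valued.v (α - ρ α) :=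
    calc Valued.v μ * Valued.v cc * Valued.v (α - ρ α) ≤ Valued.v cc * Valued.v (α - ρ α) * (Valued.v (jE ϖ) ^ b * Valued.v (jE ϖ) ^ b) := hO2
      _ = Valued.v (jE ϖ) ^ (2 * b) * (Valued.v cc * Valued.v (α - ρ α)) := by rw [two_mul, pow_add]; ac_rfl
      _ < Valued.v μ * (Valued.v cc * Valued.v (α - ρ α)) := mul_lt_mul_of_pos_right h3 (mul_pos hvcpos hvαpos)
      _ = Valued.v μ * Valued.v cc * Valued.v (α - ρ α) := (mul_assoc _ _ _).symm
  exact lt_irrefl _ hlt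

/-! ## §3 CELL HEADS — the far and the high cone cells are empty (`levelSetDep = ∅`) -/

/-- **CELL HEAD — «A FAR CONE CELL IS EMPTY».**  ★ (C1)∕★ DEFS line-model letters (`hρρ hvρ hα hα1 hint hΘΘ hΘρ hvΘ`, form scalar `h ≠ 0`, `ρ` fixes `ϖE = jE ϖ`, `|ϖ| = exp(−1)`,
`|jE c| ≤ 1 ↔ |c| ≤ 1`), the cone cell `(j, b)` with `b < j` (conductor `cc = ϖE^j`, `|cc| < |ϖE|^b`), and the FAR letters of the literal's depth multiplier `μ`:
`|ϖE^j(α − ρα)|·|μ| < |μ − ρμ|·|ϖE|^b` and `|ϖE^j(α − ρα)|·|ϖE|^b < |μ − ρμ|` (indices: `j − b > jl′ − m₀` and `j + b > jl′`).  THEN `levelSetDep ρ Θ α ϖE h j b μ = ∅` — the depth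
clause `μ·Λ^♯ ⊆ Λ` (★ DEFS `forall_herm_mul_mem_iff_isOrd_div`: `IsOrd (μ∕Y)`, `Y` the dual generator, `|Y| = |ϖE|^b`) fails for every member.
[cite: Kottwitz1986BaseChangeUnits, §1 pp. 240–241] [cite: Jacobowitz1962, §4] [cite: Serre1979, Ch. III §6 Prop. 12] -/
theorem levelSetDep_eq_empty_of_far
    (hρρ : ∀ x, ρ (ρ x) = x) (hvρ : ∀ x, Valued.v (ρ x) = Valued.v x) (hα : ρ α ≠ α) (hα1 : Valued.v α ≤ 1)
    (hint : ∀ z : M, Valued.v z ≤ 1 → Valued.v ((z - ρ z) / (α - ρ α)) ≤ 1)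
    (hΘΘ : ∀ x, Θ (Θ x) = x) (hΘρ : ∀ x, Θ (ρ x) = ρ (Θ x)) (hvΘ : ∀ x, Valued.v (Θ x) = Valued.v x)
    (jE : E →+* M) (hjv : ∀ c, Valued.v (jE c) ≤ 1 ↔ Valued.v c ≤ 1) {ϖ : E} (hϖ : Valued.v ϖ = exp (-1 : ℤ)) (hρϖ : ρ (jE ϖ) = jE ϖ)
    {h : M} (hh : h ≠ 0) {j b : ℕ} (hbj : b < j) {μ : M}
    (h1 : Valued.v (jE ϖ ^ j * (α - ρ α)) * Valued.v μ < Valued.v (μ - ρ μ) * Valued.v (jE ϖ) ^ b)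
    (h2 : Valued.v (jE ϖ ^ j * (α - ρ α)) * Valued.v (jE ϖ) ^ b < Valued.v (μ - ρ μ)) :
    levelSetDep ρ Θ α (jE ϖ) h j b μ = ∅ := by
  have hvϖ0 : Valued.v ϖ ≠ 0 := by rw [hϖ]; exact exp_ne_zero
  have hϖ0 : ϖ ≠ 0 := fun h0 => hvϖ0 (by rw [h0, map_zero])
  have hϖlt : Valued.v ϖ < 1 := by rw [hϖ, ← exp_zero, exp_lt_exp]; norm_num
  have hjϖ0 : jE ϖ ≠ 0 := (map_ne_zero jE).2 hϖ0
  have hjϖlt : Valued.v (jE ϖ) < 1 := (v_map_lt_one_iff_of_le_iff jE hjv ϖ).2 hϖlt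
  have hc : ρ (jE ϖ ^ j) = jE ϖ ^ j := by rw [map_pow, hρϖ]
  have hc0 : jE ϖ ^ j ≠ 0 := pow_ne_zero j hjϖ0
  have hc1 : Valued.v (jE ϖ ^ j) ≤ 1 := by rw [Valuation.map_pow]; exact pow_le_one₀ zero_le hjϖlt.le
  have hcb : Valued.v (jE ϖ ^ j) < Valued.v (jE ϖ) ^ b := by
    rw [Valuation.map_pow]; exact pow_lt_pow_right_of_lt_one₀ (zero_lt_iff.2 ((Valuation.ne_zero_iff _).2 hjϖ0)) hjϖlt hbj
  refine Set.subset_empty_iff.1 fun Λ hΛ => ?_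
  rw [mem_levelSetDep_iff, mem_levelSet_iff] at hΛ
  obtain ⟨⟨x₀, hx₀, hΛx, hyO, -, hylev⟩, hdep⟩ := hΛ
  have hO := (forall_herm_mul_mem_iff_isOrd_div hρρ hvρ hα hα1 hint hΘΘ hΘρ hvΘ hc hc0 hc1 hh hx₀ hΛx μ).1 hdep
  exact not_isOrd_div_of_far hvρ hα hα1 jE hϖ hyO hylev hcb h1 h2 hO

/-- **CELL HEAD — «A HIGH CONE CELL IS EMPTY».**  Same frame + `Fix ρ = jE(E)` (`hjfix`), `hEval`; the cone cell `(j, b)` with `1 ≤ b < j`; HIGH letters `|ϖE|^{2b} < |μ|`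
(strictly above the row `2b = m₀`) and `|μ − ρμ|·|ϖE|^b < |ϖE^j(α − ρα)|·|μ|` (left of the upper line `j − b = jl′ − m₀`).  THEN `levelSetDep ρ Θ α ϖE h j b μ = ∅`.
[cite: Kottwitz1986BaseChangeUnits, §1 pp. 240–241] [cite: Jacobowitz1962, §4] [cite: Serre1979, Ch. III §6 Prop. 12] -/
theorem levelSetDep_eq_empty_of_high
    (hρρ : ∀ x, ρ (ρ x) = x) (hvρ : ∀ x, Valued.v (ρ x) = Valued.v x) (hα : ρ α ≠ α) (hα1 : Valued.v α ≤ 1)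
    (hint : ∀ z : M, Valued.v z ≤ 1 → Valued.v ((z - ρ z) / (α - ρ α)) ≤ 1)
    (hΘΘ : ∀ x, Θ (Θ x) = x) (hΘρ : ∀ x, Θ (ρ x) = ρ (Θ x)) (hvΘ : ∀ x, Valued.v (Θ x) = Valued.v x)
    (jE : E →+* M) (hjv : ∀ c, Valued.v (jE c) ≤ 1 ↔ Valued.v c ≤ 1) (hjfix : ∀ z, ρ z = z ↔ ∃ c, jE c = z)
    {ϖ : E} (hϖ : Valued.v ϖ = exp (-1 : ℤ))
    (hEval : ∀ c : M, ρ c = c → c ≠ 0 → Valued.v c ≤ 1 → ∃ n : ℕ, Valued.v c = Valued.v (jE ϖ) ^ n)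
    {h : M} (hh : h ≠ 0) {j b : ℕ} (hb1 : 1 ≤ b) (hbj : b < j) {μ : M}
    (h3 : Valued.v (jE ϖ) ^ (2 * b) < Valued.v μ) (h4 : Valued.v (μ - ρ μ) * Valued.v (jE ϖ) ^ b < Valued.v (jE ϖ ^ j * (α - ρ α)) * Valued.v μ) :
    levelSetDep ρ Θ α (jE ϖ) h j b μ = ∅ := by
  have hvϖ0 : Valued.v ϖ ≠ 0 := by rw [hϖ]; exact exp_ne_zero
  have hϖ0 : ϖ ≠ 0 := fun h0 => hvϖ0 (by rw [h0, map_zero])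
  have hϖlt : Valued.v ϖ < 1 := by rw [hϖ, ← exp_zero, exp_lt_exp]; norm_num
  have hjϖ0 : jE ϖ ≠ 0 := (map_ne_zero jE).2 hϖ0
  have hjϖlt : Valued.v (jE ϖ) < 1 := (v_map_lt_one_iff_of_le_iff jE hjv ϖ).2 hϖlt
  have hρϖ : ρ (jE ϖ) = jE ϖ := (hjfix _).2 ⟨ϖ, rfl⟩
  have hc : ρ (jE ϖ ^ j) = jE ϖ ^ j := by rw [map_pow, hρϖ]
  have hc0 : jE ϖ ^ j ≠ 0 := pow_ne_zero j hjϖ0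
  have hc1 : Valued.v (jE ϖ ^ j) ≤ 1 := by rw [Valuation.map_pow]; exact pow_le_one₀ zero_le hjϖlt.le
  have hcb : Valued.v (jE ϖ ^ j) < Valued.v (jE ϖ) ^ b := by
    rw [Valuation.map_pow]; exact pow_lt_pow_right_of_lt_one₀ (zero_lt_iff.2 ((Valuation.ne_zero_iff _).2 hjϖ0)) hjϖlt hbj
  refine Set.subset_empty_iff.1 fun Λ hΛ => ?_
  rw [mem_levelSetDep_iff, mem_levelSet_iff] at hΛ
  obtain ⟨⟨x₀, hx₀, hΛx, hyO, hyp, hylev⟩, hdep⟩ := hΛ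
  have hO := (forall_herm_mul_mem_iff_isOrd_div hρρ hvρ hα hα1 hint hΘΘ hΘρ hvΘ hc hc0 hc1 hh hx₀ hΛx μ).1 hdep
  exact not_isOrd_div_of_high hρρ hvρ hα hα1 jE hjv hjfix hϖ hEval hc hc0 hyO hyp hb1 hylev hcb h3 h4 hO

end Summit.HodgeConjecture.HodgeConjecture.Cruxes.H413.F0P3cDyRamFarConeCellEmpty

end
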